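import Summits.CriticalPhenomena.PercolationContinuityZ3.Theorems.SahiBoxTP2Coupling
import Summits.CriticalPhenomena.PercolationContinuityZ3.Theorems.SahiLiebSahiContinuumDensityPrelim

/-!
# Lieb–Sahi's continuous case ⟺ Sahi positivity of EVERY box-TP₂ law on `Q_d`, all measurable monotone families

Support file of the Sahi cell (`prim-sahi`, typer seat, generation 11; `--supports stmt-CriticalPhenomena-4575`).

With the coupling theorem (`SahiBoxTP2Coupling.exists_aemonotone_coupling`: every box-TP₂ probability measure on
`Q_d = (Fin d → [0,1])` is `G_* λ_d` with `G` Borel and monotone on a full-measure set):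

* `exists_monotone_ae_eq_of_monotoneOn` — a bounded function monotone on a set of full measure agrees a.e. with an
  everywhere-monotone one (upper envelope along the good set); hence
  `msahiE_map_nonneg_of_liebSahiContinuum_of_monotoneOn`: `LiebSahiContinuum d n` controls `E_n` of every
  a.e.-monotone Borel image of `λ_d`, for bounded measurable monotone families (the generation-6
  `msahiE_map_nonneg_of_liebSahiContinuum` needed monotone everywhere);
* **`msahiE_nonneg_of_isBoxTP2`** / `…_antitone` — `LiebSahiContinuum d n` ⟹ every box-TP₂ probability measure on
  `Q_d` is Sahi-positive of order `n` for ALL measurable nonnegative monotone (resp. antitone) families: no density,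
  no continuity, singular measures allowed;
* `exists_monotone_coupling` — the everywhere-monotone (a.e.-measurable) form: every box-TP₂ law on `Q_d` is the
  law of a monotone function of a uniform point of `Q_d`;
* `isBoxTP2_of_linearOrder`, `IsBoxTP2.pi`, `isBoxTP2_volume` — every measure on a chain, and every product measure on `Q_d`, is
  box-TP₂ (so Lebesgue measure is); `IsBoxTP2.withDensity_volume` — so is every law with a measurable MTP₂ density
  w.r.t. Lebesgue (Karlin–Rinott's four functions theorem on `Q_d`, tree `SahiCubeDensity.lintegral_four_functions_unitCube`);
* **`liebSahiContinuum_iff_isBoxTP2`** — `L(d,n)` ⟺ [every box-TP₂ probability measure on `Q_d` is Sahi-positive of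
  order `n` for measurable monotone families]: the regularity-free form of items 2–3 of the continuum theorem
  (`liebSahiContinuum_iff_pi`, `SahiCubeDensity.liebSahiContinuum_iff_withDensity`), now containing the singular laws;
* unconditional layers: `msahiE_nonneg_of_isBoxTP2_of_le_two` (`d ≤ 2`, every `n`),
  `msahiE_nonneg_of_isBoxTP2_of_order_le_two` (`n ≤ 2`, every `d`); the cell `(3,3)` is in
  `SahiBoxTP2GridThree.lean` (computational certificate of `SahiGrid3.liebSahiContinuum_three_three`).

No sorries, no new axioms.
-/

noncomputable section

namespace Summit.CriticalPhenomena.PercolationContinuityZ3.Theorems.SahiBoxTP2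

open MeasureTheory ProbabilityTheory Set Filter Topology Function Literature.Combinatorics.Sahi2008
open scoped ENNReal unitInterval

/-! ### A.e.-monotone functions agree a.e. with monotone ones -/

section Envelope

variable {Ω : Type*} [Preorder Ω] [MeasurableSpace Ω] (μ : Measure Ω)

/-- **Upper envelope**: a nonnegative bounded function monotone on a set `S` of full measure agrees a.e. with the
everywhere-monotone function `u ↦ sup ({g s : s ∈ S, s ≤ u} ∪ {0})`. [folklore] -/
theorem exists_monotone_ae_eq_of_monotoneOn {g : Ω → ℝ} {S : Set Ω} (hS : ∀ᵐ x ∂μ, x ∈ S) (hg : MonotoneOn g S)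
    (hg0 : ∀ x, 0 ≤ g x) {M : ℝ} (hgM : ∀ x, g x ≤ M) :
    ∃ l : Ω → ℝ, Monotone l ∧ (∀ x, 0 ≤ l x) ∧ g =ᵐ[μ] l := by
  set A : Ω → Set ℝ := fun u => insert 0 (g '' {s | s ∈ S ∧ s ≤ u}) with hA
  have hbdd : ∀ u, BddAbove (A u) := fun u => ⟨max M 0, fun y hy => by
    rcases mem_insert_iff.1 hy with rfl | ⟨s, _, rfl⟩
    · exact le_max_right _ _
    · exact (hgM s).trans (le_max_left _ _)⟩
  have hne : ∀ u, (A u).Nonempty := fun u => ⟨0, mem_insert _ _⟩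
  refine ⟨fun u => sSup (A u), fun u v huv => csSup_le_csSup (hbdd v) (hne u)
    (insert_subset_insert (image_mono fun s hs => ⟨hs.1, hs.2.trans huv⟩)),
    fun u => le_csSup (hbdd u) (mem_insert _ _), ?_⟩
  filter_upwards [hS] with u hu
  refine le_antisymm (le_csSup (hbdd u) (mem_insert_of_mem _ ⟨u, ⟨hu, le_rfl⟩, rfl⟩)) (csSup_le (hne u) ?_)
  intro y hy
  rcases mem_insert_iff.1 hy with rfl | ⟨s, hs, rfl⟩
  · exact hg0 u
  · exact hg hs.1 hu hs.2

/-- **Lower-set twin**: a nonnegative bounded function antitone on a set of full measure agrees a.e. with an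
everywhere-antitone function. [folklore] -/
theorem exists_antitone_ae_eq_of_antitoneOn {g : Ω → ℝ} {S : Set Ω} (hS : ∀ᵐ x ∂μ, x ∈ S) (hg : AntitoneOn g S)
    (hg0 : ∀ x, 0 ≤ g x) {M : ℝ} (hgM : ∀ x, g x ≤ M) :
    ∃ l : Ω → ℝ, Antitone l ∧ (∀ x, 0 ≤ l x) ∧ g =ᵐ[μ] l := by
  set A : Ω → Set ℝ := fun u => insert 0 (g '' {s | s ∈ S ∧ u ≤ s}) with hA
  have hbdd : ∀ u, BddAbove (A u) := fun u => ⟨max M 0, fun y hy => by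
    rcases mem_insert_iff.1 hy with rfl | ⟨s, _, rfl⟩
    · exact le_max_right _ _
    · exact (hgM s).trans (le_max_left _ _)⟩
  have hne : ∀ u, (A u).Nonempty := fun u => ⟨0, mem_insert _ _⟩
  refine ⟨fun u => sSup (A u), fun u v huv => csSup_le_csSup (hbdd u) (hne v)
    (insert_subset_insert (image_mono fun s hs => ⟨hs.1, huv.trans hs.2⟩)),
    fun u => le_csSup (hbdd u) (mem_insert _ _), ?_⟩
  filter_upwards [hS] with u hu
  refine le_antisymm (le_csSup (hbdd u) (mem_insert_of_mem _ ⟨u, ⟨hu, le_rfl⟩, rfl⟩)) (csSup_le (hne u) ?_)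
  intro y hy
  rcases mem_insert_iff.1 hy with rfl | ⟨s, hs, rfl⟩
  · exact hg0 u
  · exact hg hu hs.1 hs.2

end Envelope

/-! ### The continuous case controls every a.e.-monotone image of Lebesgue measure -/

variable {d n : ℕ}

/-- **A.e.-monotone images of Lebesgue measure**: if `LiebSahiContinuum d n` holds then for every measurable
`G : Q_d → Ω` into a measurable preorder that is monotone on a set of full Lebesgue measure, `E_n(f_0,…,f_{n−1}) ≥ 0`
under `G_* λ_d` for all bounded nonnegative monotone measurable `f_i : Ω → ℝ` (pull back along `G`, then replace
each `f_i ∘ G` by its monotone upper envelope, a.e. equal to it, with the same joint moments). [this work] -/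
theorem msahiE_map_nonneg_of_liebSahiContinuum_of_monotoneOn (h : LiebSahiContinuum d n) {Ω : Type*}
    [MeasurableSpace Ω] [Preorder Ω] {G : (Fin d → I) → Ω} (hGm : Measurable G) {S : Set (Fin d → I)}
    (hS : ∀ᵐ x ∂(volume : Measure (Fin d → I)), x ∈ S) (hG : MonotoneOn G S) (f : Fin n → Ω → ℝ)
    (hfm : ∀ i, Measurable (f i)) (hf0 : ∀ i p, 0 ≤ f i p) (M : Fin n → ℝ) (hfM : ∀ i p, f i p ≤ M i)
    (hmono : ∀ i, Monotone (f i)) : 0 ≤ msahiE ((volume : Measure (Fin d → I)).map G) n f := by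
  have hmp : MeasurePreserving G volume ((volume : Measure (Fin d → I)).map G) := ⟨hGm, rfl⟩
  rw [← msahiE_comp_measurePreserving_of_measurable hmp n f hfm]
  have hgS : ∀ i, MonotoneOn (f i ∘ G) S := fun i x hx y hy hxy => hmono i (hG hx hy hxy)
  choose l hlmono hl0 hgl using fun i => exists_monotone_ae_eq_of_monotoneOn (volume : Measure (Fin d → I)) hS
    (hgS i) (fun x => hf0 i _) (fun x => hfM i (G x))
  rw [msahiE_congr_of_moments _ _ (fun i => f i ∘ G) l fun T => LebesgueCube.integral_prod_congr_ae hgl T]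
  exact liebSahiContinuum_iff_mSahiPositive.1 h l hl0 hlmono

/-- The same for bounded ANTITONE measurable families. [this work] -/
theorem msahiE_map_nonneg_of_liebSahiContinuum_of_monotoneOn_antitone (h : LiebSahiContinuum d n) {Ω : Type*}
    [MeasurableSpace Ω] [Preorder Ω] {G : (Fin d → I) → Ω} (hGm : Measurable G) {S : Set (Fin d → I)}
    (hS : ∀ᵐ x ∂(volume : Measure (Fin d → I)), x ∈ S) (hG : MonotoneOn G S) (f : Fin n → Ω → ℝ)
    (hfm : ∀ i, Measurable (f i)) (hf0 : ∀ i p, 0 ≤ f i p) (M : Fin n → ℝ) (hfM : ∀ i p, f i p ≤ M i)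
    (hanti : ∀ i, Antitone (f i)) : 0 ≤ msahiE ((volume : Measure (Fin d → I)).map G) n f := by
  have hmp : MeasurePreserving G volume ((volume : Measure (Fin d → I)).map G) := ⟨hGm, rfl⟩
  rw [← msahiE_comp_measurePreserving_of_measurable hmp n f hfm]
  have hgS : ∀ i, AntitoneOn (f i ∘ G) S := fun i x hx y hy hxy => hanti i (hG hx hy hxy)
  choose l hlanti hl0 hgl using fun i => exists_antitone_ae_eq_of_antitoneOn (volume : Measure (Fin d → I)) hS
    (hgS i) (fun x => hf0 i _) (fun x => hfM i (G x))
  rw [msahiE_congr_of_moments _ _ (fun i => f i ∘ G) l fun T => LebesgueCube.integral_prod_congr_ae hgl T]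
  exact h l hl0 hlanti

/-! ### Box-TP₂ laws are Sahi-positive (given the continuous case) -/

/-- **`LiebSahiContinuum d n` ⟹ every box-TP₂ probability measure on `Q_d` is Sahi-positive of order `n`**, for ALL
measurable nonnegative monotone families — no density, no continuity, singular laws allowed. [this work] -/
theorem msahiE_nonneg_of_isBoxTP2 (h : LiebSahiContinuum d n) (μ : Measure (Fin d → I)) [IsProbabilityMeasure μ]
    (hμ : IsBoxTP2 μ) (f : Fin n → (Fin d → I) → ℝ) (hfm : ∀ i, Measurable (f i)) (hf0 : ∀ i x, 0 ≤ f i x)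
    (hmono : ∀ i, Monotone (f i)) : 0 ≤ msahiE μ n f := by
  obtain ⟨G, S, hGm, hS, hG, hGμ⟩ := exists_aemonotone_coupling d μ hμ
  rw [← hGμ]
  exact msahiE_map_nonneg_of_liebSahiContinuum_of_monotoneOn h hGm hS hG f hfm hf0 (fun i => f i ⊤)
    (fun i x => hmono i le_top) hmono

/-- The same for measurable nonnegative ANTITONE families (Lieb–Sahi's "positive monotone (decreasing)" functions).
[this work] -/
theorem msahiE_nonneg_of_isBoxTP2_antitone (h : LiebSahiContinuum d n) (μ : Measure (Fin d → I))
    [IsProbabilityMeasure μ] (hμ : IsBoxTP2 μ) (f : Fin n → (Fin d → I) → ℝ) (hfm : ∀ i, Measurable (f i))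
    (hf0 : ∀ i x, 0 ≤ f i x) (hanti : ∀ i, Antitone (f i)) : 0 ≤ msahiE μ n f := by
  obtain ⟨G, S, hGm, hS, hG, hGμ⟩ := exists_aemonotone_coupling d μ hμ
  rw [← hGμ]
  exact msahiE_map_nonneg_of_liebSahiContinuum_of_monotoneOn_antitone h hGm hS hG f hfm hf0 (fun i => f i ⊥)
    (fun i x => hanti i bot_le) hanti

/-! ### Everywhere-monotone version of the coupling (almost-everywhere measurable) -/

/-- **Every box-TP₂ probability measure on `Q_d` is the law of a MONOTONE function of a uniform point**: there is
an everywhere-monotone `Φ : Q_d → Q_d`, a.e. equal to a Borel map (so a.e.-measurable), with `Φ_* λ_d = μ` — the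
upper envelope `u ↦ sup {G s : s ∈ S₀, s ≤ u}` of the a.e.-monotone Borel coupling `G` of
`SahiBoxTP2Coupling.exists_aemonotone_coupling` along a conull Borel set `S₀` on which `G` is monotone (suprema in the
complete lattice `Q_d`).  For `d ≥ 2` a Borel AND everywhere-monotone version is not claimed. [this work] -/
theorem exists_monotone_coupling (d : ℕ) (μ : Measure (Fin d → I)) [IsProbabilityMeasure μ] (hμ : IsBoxTP2 μ) :
    ∃ Φ : (Fin d → I) → (Fin d → I), Monotone Φ ∧ AEMeasurable Φ (volume : Measure (Fin d → I)) ∧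
      (volume : Measure (Fin d → I)).map Φ = μ := by
  obtain ⟨G, S, hGm, hS, hG, hGμ⟩ := exists_aemonotone_coupling d μ hμ
  set N : Set (Fin d → I) := toMeasurable volume {x | x ∉ S} with hN
  have hN0 : (volume : Measure (Fin d → I)) N = 0 := by rw [hN, measure_toMeasurable]; exact ae_iff.1 hS
  have hNS : ∀ x, x ∉ N → x ∈ S := fun x hx => by
    by_contra h
    exact hx (subset_toMeasurable _ _ h)
  set Φ : (Fin d → I) → (Fin d → I) := fun u => sSup (G '' {s | s ∉ N ∧ s ≤ u}) with hΦ
  have hΦG : ∀ u, u ∉ N → Φ u = G u := fun u hu =>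
    le_antisymm (sSup_le fun y ⟨s, hs, hsy⟩ => hsy ▸ hG (hNS s hs.1) (hNS u hu) hs.2)
      (le_sSup (mem_image_of_mem G ⟨hu, le_rfl⟩))
  have hae : Φ =ᵐ[volume] G := by
    have h : ∀ᵐ u ∂(volume : Measure (Fin d → I)), u ∉ N := measure_eq_zero_iff_ae_notMem.1 hN0
    filter_upwards [h] with u hu using hΦG u hu
  refine ⟨Φ, fun u v huv => sSup_le_sSup (image_mono fun s hs => ⟨hs.1, hs.2.trans huv⟩),
    ⟨G, hGm, hae⟩, ?_⟩
  rw [Measure.map_congr hae, hGμ]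

/-! ### Sources of box-TP₂ laws: chains, products, MTP₂ densities -/

/-- **Every measure on a chain is box-TP₂** (the one-dimensional inequality
`m[a,b] m[a',b'] ≤ m[a,b'] m[a',b]` for nested intervals; equality for ordered ones). [folklore] -/
theorem isBoxTP2_of_linearOrder {γ : Type*} [LinearOrder γ] [TopologicalSpace γ] [OrderClosedTopology γ]
    [MeasurableSpace γ] [OpensMeasurableSpace γ] (m : Measure γ) : IsBoxTP2 m := by
  -- the case `a ≤ a'`
  have key : ∀ a b a' b' : γ, a ≤ a' →
      m (Icc a b) * m (Icc a' b') ≤ m (Icc (a ⊓ a') (b ⊓ b')) * m (Icc (a ⊔ a') (b ⊔ b')) := by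
    intro a b a' b' haa'
    rw [inf_eq_left.2 haa', sup_eq_right.2 haa']
    rcases le_or_gt b b' with hbb' | hbb'
    · rw [inf_eq_left.2 hbb', sup_eq_right.2 hbb']
    rw [inf_eq_right.2 hbb'.le, sup_eq_left.2 hbb'.le]
    rcases lt_or_ge b' a' with hab | hab
    · rw [Icc_eq_empty (not_le.2 hab), measure_empty, mul_zero]
      exact zero_le
    -- `a ≤ a' ≤ b' < b`
    have hab' : a ≤ b' := haa'.trans hab
    have h1 : Icc a b = Icc a b' ∪ Ioc b' b := (Icc_union_Ioc_eq_Icc hab' hbb'.le).symm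
    have h2 : Icc a' b = Icc a' b' ∪ Ioc b' b := (Icc_union_Ioc_eq_Icc hab hbb'.le).symm
    have hd1 : Disjoint (Icc a b') (Ioc b' b) := fun s h1' h2' x hx => (not_lt.2 (h1' hx).2 (h2' hx).1).elim
    have hd2 : Disjoint (Icc a' b') (Ioc b' b) := fun s h1' h2' x hx => (not_lt.2 (h1' hx).2 (h2' hx).1).elim
    rw [h1, h2, measure_union hd1 measurableSet_Ioc, measure_union hd2 measurableSet_Ioc, add_mul, mul_add]
    refine add_le_add le_rfl ?_
    rw [mul_comm]
    exact mul_le_mul' (measure_mono (Icc_subset_Icc_left haa')) le_rfl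
  intro a b a' b'
  rcases le_total a a' with h | h
  · exact key a b a' b' h
  · rw [mul_comm (m (Icc a b)), inf_comm a, inf_comm b, sup_comm a, sup_comm b]
    exact key a' b' a b h

/-- **Product measures on products of chains are box-TP₂** (coordinatewise; in particular every product
probability measure on `Q_d` or on `ℝ^d`, and Lebesgue measure). [folklore] -/
theorem IsBoxTP2.pi {γ : Type*} [LinearOrder γ] [TopologicalSpace γ] [OrderClosedTopology γ] [MeasurableSpace γ]
    [OpensMeasurableSpace γ] (μ : Fin d → Measure γ) [∀ i, SigmaFinite (μ i)] : IsBoxTP2 (Measure.pi μ) := by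
  intro a b a' b'
  rw [← Set.pi_univ_Icc, ← Set.pi_univ_Icc, ← Set.pi_univ_Icc, ← Set.pi_univ_Icc, Measure.pi_pi, Measure.pi_pi,
    Measure.pi_pi, Measure.pi_pi, ← Finset.prod_mul_distrib, ← Finset.prod_mul_distrib]
  exact Finset.prod_le_prod' fun i _ => isBoxTP2_of_linearOrder (μ i) (a i) (b i) (a' i) (b' i)

/-- **Lebesgue measure on `Q_d` is box-TP₂.** [folklore] -/
theorem isBoxTP2_volume : IsBoxTP2 (volume : Measure (Fin d → I)) :=
  IsBoxTP2.pi fun _ => volume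

/-- **MTP₂ densities give box-TP₂ laws**: if `ρ : Q_d → [0,∞]` is measurable with `ρ(x)ρ(y) ≤ ρ(x ∨ y)ρ(x ∧ y)`,
then `ρ dλ_d` is box-TP₂ (Karlin–Rinott's continuous four functions theorem on `Q_d` with the four functions
`ρ·1_{box}`). [folklore] -/
theorem IsBoxTP2.withDensity_volume (ρ : (Fin d → I) → ℝ≥0∞) (hρm : Measurable ρ)
    (hρ : ∀ x y, ρ x * ρ y ≤ ρ (x ⊔ y) * ρ (x ⊓ y)) : IsBoxTP2 ((volume : Measure (Fin d → I)).withDensity ρ) := by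
  intro a b a' b'
  rw [withDensity_apply _ measurableSet_Icc, withDensity_apply _ measurableSet_Icc,
    withDensity_apply _ measurableSet_Icc, withDensity_apply _ measurableSet_Icc, ← lintegral_indicator measurableSet_Icc,
    ← lintegral_indicator measurableSet_Icc, ← lintegral_indicator measurableSet_Icc,
    ← lintegral_indicator measurableSet_Icc, mul_comm (∫⁻ x, (Icc (a ⊓ a') (b ⊓ b')).indicator ρ x)]
  refine SahiCubeDensity.lintegral_four_functions_unitCube _ _ _ _ ((hρm.indicator measurableSet_Icc))
    (hρm.indicator measurableSet_Icc) (hρm.indicator measurableSet_Icc) (hρm.indicator measurableSet_Icc)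
    fun x y => ?_
  by_cases hx : x ∈ Icc a b
  · by_cases hy : y ∈ Icc a' b'
    · rw [indicator_of_mem hx, indicator_of_mem hy,
        indicator_of_mem (show x ⊔ y ∈ Icc (a ⊔ a') (b ⊔ b') from ⟨sup_le_sup hx.1 hy.1, sup_le_sup hx.2 hy.2⟩),
        indicator_of_mem (show x ⊓ y ∈ Icc (a ⊓ a') (b ⊓ b') from ⟨inf_le_inf hx.1 hy.1, inf_le_inf hx.2 hy.2⟩)]
      exact hρ x y
    · rw [indicator_of_notMem hy, mul_zero]
      exact zero_le
  · rw [indicator_of_notMem hx, zero_mul]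
    exact zero_le

/-! ### The equivalence and the unconditional layers -/

/-- **Lieb–Sahi's continuous case of order `n` on `Q_d` ⟺ every box-TP₂ probability measure on `Q_d` is
Sahi-positive of order `n` for all measurable nonnegative monotone families** (⇐: Lebesgue measure is box-TP₂ and
`E_n` for Lebesgue measure only needs Borel families). [this work] -/
theorem liebSahiContinuum_iff_isBoxTP2 :
    LiebSahiContinuum d n ↔ ∀ μ : Measure (Fin d → I), IsProbabilityMeasure μ → IsBoxTP2 μ →
      ∀ f : Fin n → (Fin d → I) → ℝ, (∀ i, Measurable (f i)) → (∀ i x, 0 ≤ f i x) → (∀ i, Monotone (f i)) →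
        0 ≤ msahiE μ n f := by
  refine ⟨fun h μ hμP hμ f hfm hf0 hmono => ?_, fun h => ?_⟩
  · haveI := hμP
    exact msahiE_nonneg_of_isBoxTP2 h μ hμ f hfm hf0 hmono
  · exact liebSahiContinuum_iff_mSahiPositive.2
      (LebesgueCube.mSahiPositive_volume_of_measurable fun f hfm hf0 hmono =>
        h volume inferInstance isBoxTP2_volume f hfm hf0 hmono)

/-- **Unconditionally, `d ≤ 2`**: every box-TP₂ probability measure on `[0,1]` or on the unit square is
Sahi-positive of EVERY order for all measurable nonnegative monotone families (Lieb–Sahi's Theorem 3.7 behind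
`liebSahiContinuum_of_le_two`). [this work] -/
theorem msahiE_nonneg_of_isBoxTP2_of_le_two (hd : d ≤ 2) (μ : Measure (Fin d → I)) [IsProbabilityMeasure μ]
    (hμ : IsBoxTP2 μ) (n : ℕ) (f : Fin n → (Fin d → I) → ℝ) (hfm : ∀ i, Measurable (f i))
    (hf0 : ∀ i x, 0 ≤ f i x) (hmono : ∀ i, Monotone (f i)) : 0 ≤ msahiE μ n f :=
  msahiE_nonneg_of_isBoxTP2 (liebSahiContinuum_of_le_two hd n) μ hμ f hfm hf0 hmono

/-- **Unconditionally, `n ≤ 2`**: every box-TP₂ probability measure on `Q_d` (every `d`) satisfies `E_1, E_2 ≥ 0`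
— `E_2 ≥ 0` is the FKG inequality for box-TP₂ (possibly singular) laws on the cube, for all measurable
nonnegative monotone pairs. [this work] -/
theorem msahiE_nonneg_of_isBoxTP2_of_order_le_two (hn : n ≤ 2) (μ : Measure (Fin d → I))
    [IsProbabilityMeasure μ] (hμ : IsBoxTP2 μ) (f : Fin n → (Fin d → I) → ℝ) (hfm : ∀ i, Measurable (f i))
    (hf0 : ∀ i x, 0 ≤ f i x) (hmono : ∀ i, Monotone (f i)) : 0 ≤ msahiE μ n f :=
  msahiE_nonneg_of_isBoxTP2 (liebSahiContinuum_of_order_le_two d hn) μ hμ f hfm hf0 hmono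

end Summit.CriticalPhenomena.PercolationContinuityZ3.Theorems.SahiBoxTP2
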